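import Literature.Topology.FourManifolds.RotationBody
import Literature.Topology.FourManifolds.CollarReparamCalculus
import HarnessLib

/-!
# The annular chart of a tube around a circle in a surface (polar coordinates)

Helper file (`--supports stmt-SmoothPoincare4-18000`, registered helper
`helper_exists_annularChart_pushoff` of the skeleton
`Cruxes/DependentTripleGenusThreeStandard/Lines/Sketch.lean`, Aux1).

Let `N` be a smooth surface and `ν : 𝕊¹ × ℝ¹ → N` a smooth embedding (a tube around the circle
`u ↦ ν (u, 0)`).  Reading the tube in polar coordinates of the plane,
`φ x = ν (x/‖x‖, (‖x‖ - 1) e₀)`, gives a plane map `φ : ℝ² → N` which on the punctured plane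
`{x ≠ 0}` is smooth, injective and has injective differential, and whose round circle of
radius `r > 0` is the parallel circle `u ↦ ν (u, (r - 1) e₀)` of the tube
(`helper_annularChart_of_circleTube`, REGISTERED helper).  The polar map
`x ↦ (x/‖x‖, (‖x‖ - 1) e₀)` has the smooth left inverse `(u, t) ↦ (t₀ + 1) u`, which gives
injectivity and, by the chain rule, injectivity of its differential; the differential of `ν` is
injective because `ν` is a smooth embedding (`injective_mfderiv_of_isSmoothEmbedding`).

Everything is proved; no definitions, no named facts.

References: M. W. Hirsch, *Differential Topology* (1976), Ch. 4 §5 (tubular neighbourhoods),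
Ch. 1 §3; J. M. Lee, *Introduction to Smooth Manifolds* (2013), Prop. 4.22.
-/

-- the registered namespace `Summit.SmoothPoincare4.SmoothPoincare4.Theorems…` repeats a component
set_option linter.dupNamespace false

noncomputable section

open scoped Manifold ContDiff Topology
open Set Function Metric Module
open Literature.Topology.FourManifolds

namespace Summit.SmoothPoincare4.SmoothPoincare4.Theorems

/-- **The annular chart of a tube around a circle in a surface.**  For a smooth embedding
`ν : 𝕊¹ × ℝ¹ → N` into a smooth surface, the plane map `φ x = ν (x/‖x‖, (‖x‖ - 1) e₀)` is
smooth, injective and immersive on the punctured plane, and `φ (r • u) = ν (u, (r - 1) e₀)`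
for `r > 0` and unit vectors `u` (polar coordinates; REGISTERED helper of the crux
`DependentTripleGenusThreeStandard`, line `Sketch`).
[cite: HirschDT1976, Ch. 4 §5 Thm. 5.1 and Ch. 1 §3 Thm. 3.1] -/
theorem helper_annularChart_of_circleTube :
    ∀ (N : Type) [TopologicalSpace N] [ChartedSpace (EuclideanSpace ℝ (Fin 2)) N]
      [IsManifold (𝓡 2) ∞ N]
      (ν : Metric.sphere (0 : EuclideanSpace ℝ (Fin 2)) 1 × EuclideanSpace ℝ (Fin 1) → N),
      Manifold.IsSmoothEmbedding ((𝓡 1).prod (𝓡 1)) (𝓡 2) ∞ ν →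
      ∃ φ : EuclideanSpace ℝ (Fin 2) → N,
        ContMDiffOn (𝓡 2) (𝓡 2) ∞ φ {x | x ≠ 0} ∧ Set.InjOn φ {x | x ≠ 0} ∧
        (∀ x : EuclideanSpace ℝ (Fin 2), x ≠ 0 →
          Function.Injective (mfderiv (𝓡 2) (𝓡 2) φ x)) ∧
        ∀ (r : ℝ), 0 < r → ∀ u : Metric.sphere (0 : EuclideanSpace ℝ (Fin 2)) 1,
          φ (r • (u : EuclideanSpace ℝ (Fin 2))) =
            ν (u, (r - 1) • EuclideanSpace.single (0 : Fin 1) (1 : ℝ)) := by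
  intro N _ _ _ ν hν
  haveI : Fact (finrank ℝ (EuclideanSpace ℝ (Fin 2)) = 1 + 1) := ⟨finrank_euclideanSpace_fin⟩
  set e₁ : EuclideanSpace ℝ (Fin 1) := EuclideanSpace.single (0 : Fin 1) (1 : ℝ) with he₁
  set x₀ : Metric.sphere (0 : EuclideanSpace ℝ (Fin 2)) 1 :=
    ⟨EuclideanSpace.single 0 1, by simp⟩ with hx₀_def
  haveI : Nonempty (Metric.sphere (0 : EuclideanSpace ℝ (Fin 2)) 1 × EuclideanSpace ℝ (Fin 1)) :=
    ⟨(x₀, 0)⟩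
  -- the polar map `P` and its left inverse `Q`
  set P : EuclideanSpace ℝ (Fin 2) →
      Metric.sphere (0 : EuclideanSpace ℝ (Fin 2)) 1 × EuclideanSpace ℝ (Fin 1) :=
    fun x => (RotationBody.sphN x, (‖x‖ - 1) • e₁) with hP_def
  set Q : Metric.sphere (0 : EuclideanSpace ℝ (Fin 2)) 1 × EuclideanSpace ℝ (Fin 1) →
      EuclideanSpace ℝ (Fin 2) :=
    fun p => (p.2 0 + 1) • (p.1 : EuclideanSpace ℝ (Fin 2)) with hQ_def
  have he₁0 : e₁ 0 = 1 := by simp [he₁]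
  have hQP : ∀ x : EuclideanSpace ℝ (Fin 2), x ≠ 0 → Q (P x) = x := fun x hx => by
    simp only [hQ_def, hP_def, PiLp.smul_apply, smul_eq_mul, he₁0, mul_one, sub_add_cancel]
    exact RotationBody.norm_smul_coe_sphN hx
  have hO : IsOpen {x : EuclideanSpace ℝ (Fin 2) | x ≠ 0} := isOpen_ne
  have hP : ContMDiffOn (𝓡 2) ((𝓡 1).prod (𝓡 1)) ∞ P {x | x ≠ 0} := by
    refine ContMDiffOn.prodMk ?_ ?_
    · exact RotationBody.contMDiffOn_sphN (m := 1)
    · have h2 : ContDiffOn ℝ ∞ (fun x : EuclideanSpace ℝ (Fin 2) => (‖x‖ - 1) • e₁) {x | x ≠ 0} :=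
        fun x hx => (((contDiffAt_norm ℝ hx).sub contDiffAt_const).smul
          contDiffAt_const).contDiffWithinAt
      exact h2.contMDiffOn
  have hQ : ContMDiff ((𝓡 1).prod (𝓡 1)) (𝓡 2) ∞ Q := by
    have h1 : ContMDiff ((𝓡 1).prod (𝓡 1)) 𝓘(ℝ, ℝ) ∞
        fun p : Metric.sphere (0 : EuclideanSpace ℝ (Fin 2)) 1 × EuclideanSpace ℝ (Fin 1) =>
          p.2 0 + 1 := by
      have h : ContDiff ℝ ∞ fun t : EuclideanSpace ℝ (Fin 1) => t 0 + 1 := by fun_prop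
      exact h.contMDiff.comp contMDiff_snd
    have h2 : ContMDiff ((𝓡 1).prod (𝓡 1)) 𝓘(ℝ, EuclideanSpace ℝ (Fin 2)) ∞
        fun p : Metric.sphere (0 : EuclideanSpace ℝ (Fin 2)) 1 × EuclideanSpace ℝ (Fin 1) =>
          (p.1 : EuclideanSpace ℝ (Fin 2)) :=
      contMDiff_coe_sphere.comp contMDiff_fst
    have h3 : ContDiff ℝ ∞ fun q : ℝ × EuclideanSpace ℝ (Fin 2) => q.1 • q.2 := contDiff_smul
    exact h3.contMDiff.comp (h1.prodMk_space h2)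
  -- the chart
  refine ⟨fun x => ν (P x), hν.contMDiff.comp_contMDiffOn hP, ?_, ?_, ?_⟩
  · -- injectivity
    intro x hx x' hx' hxx'
    have hPP : P x = P x' := hν.isEmbedding.injective hxx'
    rw [← hQP x hx, ← hQP x' hx', hPP]
  · -- injective differential
    intro x hx
    have hPx : MDifferentiableAt (𝓡 2) ((𝓡 1).prod (𝓡 1)) P x :=
      ((hP x hx).contMDiffAt (hO.mem_nhds hx)).mdifferentiableAt (by simp)
    have hQx : MDifferentiableAt ((𝓡 1).prod (𝓡 1)) (𝓡 2) Q (P x) :=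
      (hQ _).mdifferentiableAt (by simp)
    have hνx : MDifferentiableAt ((𝓡 1).prod (𝓡 1)) (𝓡 2) ν (P x) :=
      (hν.contMDiff _).mdifferentiableAt (by simp)
    have hev : Q ∘ P =ᶠ[𝓝 x] id := by
      filter_upwards [hO.mem_nhds hx] with y hy
      exact hQP y hy
    have hid : (mfderiv ((𝓡 1).prod (𝓡 1)) (𝓡 2) Q (P x)).comp
        (mfderiv (𝓡 2) ((𝓡 1).prod (𝓡 1)) P x) = ContinuousLinearMap.id ℝ _ := by
      rw [← mfderiv_comp x hQx hPx, hev.mfderiv_eq, mfderiv_id]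
    have hPinj : Injective (mfderiv (𝓡 2) ((𝓡 1).prod (𝓡 1)) P x) := by
      intro v w hvw
      have := congrArg (mfderiv ((𝓡 1).prod (𝓡 1)) (𝓡 2) Q (P x)) hvw
      rw [← ContinuousLinearMap.comp_apply, ← ContinuousLinearMap.comp_apply, hid] at this
      exact this
    have hνinj : Injective (mfderiv ((𝓡 1).prod (𝓡 1)) (𝓡 2) ν (P x)) :=
      injective_mfderiv_of_isSmoothEmbedding hν (by simp) _
    have hcomp : mfderiv (𝓡 2) (𝓡 2) (fun x => ν (P x)) x =
        (mfderiv ((𝓡 1).prod (𝓡 1)) (𝓡 2) ν (P x)).comp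
          (mfderiv (𝓡 2) ((𝓡 1).prod (𝓡 1)) P x) := by
      rw [show (fun x => ν (P x)) = ν ∘ P from rfl, mfderiv_comp x hνx hPx]
    rw [hcomp]
    exact hνinj.comp hPinj
  · -- round circles
    intro r hr u
    have hu1 : ‖(u : EuclideanSpace ℝ (Fin 2))‖ = 1 := norm_eq_of_mem_sphere u
    have hu0 : (u : EuclideanSpace ℝ (Fin 2)) ≠ 0 := by
      intro h; rw [h, norm_zero] at hu1; exact zero_ne_one hu1
    show ν (P (r • (u : EuclideanSpace ℝ (Fin 2)))) = _
    have hPu : P (r • (u : EuclideanSpace ℝ (Fin 2))) = (u, (r - 1) • e₁) := by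
      simp only [hP_def]
      rw [RotationBody.sphN_smul hr hu0, RotationBody.sphN_coe, norm_smul, Real.norm_of_nonneg hr.le,
        hu1, mul_one]
    rw [hPu]

end Summit.SmoothPoincare4.SmoothPoincare4.Theorems

end
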